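import Summits.CriticalPhenomena.CardyFormulaZ2.Theorems.CardySusyWardParafermionPrecompactDartDictionary
import Literature.Barriers.CriticalPhenomena.FKParafermionicHalfCauchyRiemann

/-!
# Core estimate of the bypass (line `Sketch`, crux `CardySusyWard.WeakHolomorphy`, stmt-CriticalPhenomena-11292)

Lead prover `prover-line-stmt-CriticalPhenomena-11292-0`; registered stub `stub_coreEstimate`.
The deterministic inequality at ONE mesh behind the reduction of weak discrete holomorphy of the
`q = 1`, spin-`1/3` parafermionic vertex observable to `L¹` defect bounds of the dart observable:
for every test function `φ` (with `∂̄φ`, `∂φ`, `φ` vanishing off `K` and bounded), every dart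
function `Fd` (`‖Fd‖ ≤ 1`) and splitting function `G` (`‖G‖ ≤ δ⁻¹`),
`‖Σ_{p∈S} ∂̄φ(z_p)·Σ_k Fd(c_{p,k})‖ ≤ 2|C'C_φ|(1+δ⁻¹)C_N + (2B_d + 8B_φ)·ε·δ^{-5/3}`
whenever the per-corner symmetrised weights are `≤ C'C_φδ²` (`stub_taylorComb`), `δ²|S| ≤ C_N`
(`stub_count`), the exact twin regrouping holds (`stub_regroup`, taken as a hypothesis) and the three
`L¹` defects over a finite set `T ⊇ {p ∈ S above K}` are `≤ εδ^{-2/3}`, `≤ εδ^{-5/3}` — via the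
per-vertex expansion `Σ_k w(p,k)Φ(c_k) = ∂̄φ·ΣΦ + i∂φ·(Φ₁+Φ₃−Φ₀−Φ₂) − (2(1−i)/δ)φ·halfCRForm i p Φ`
(MASTER identity of the line; `Cruxes/WeakHolomorphy/Lines/Sketch.lean`). Also: small lattice lemmas
(`mv = medialVertexOf`, injectivity, the class/clockwise corner tables agree) and `rpow` bookkeeping.
References: Duminil-Copin–Smirnov 2012 (arXiv:1109.1549) §8.3; Duminil-Copin 2012 (arXiv:1208.3787)
Prop. 4; crux workfiles `Cruxes/WeakHolomorphy/{Disproof.lean §D, DerivIdeator2G2.md §1}`.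
-/

noncomputable section

namespace Summit.CriticalPhenomena.CardyFormulaZ2.Theorems.WeakHolomorphy.SplitBypass

open scoped BigOperators Topology
open Filter Set MeasureTheory Complex
open _root_.Literature.Probability.LatticeModels
open _root_.Literature.Probability.RandomPlanarGeometry (DobrushinDomain)
open _root_.Literature.Probability.Percolation (BondConfig bondPercolation half)
open _root_.Literature.Barriers.CriticalPhenomena (medialCornersAt medialVertexOf halfCRForm HalfCRRelationAt)
open _root_.Literature.Barriers.CriticalPhenomena.HalfCRGreen (coeff twin)
open Summit.CriticalPhenomena.CardyFormulaZ2.Theorems.ParafermionPrecompact.Negative (F IsFamily)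
open Summit.CriticalPhenomena.CardyFormulaZ2.Cruxes.ParafermionPrecompact.KenyonStreamSecondRelation
  (mv ex pivotOf classOffset classComp dartField kappa)

/-! ## Small lattice lemmas -/

/-- The sibling line's `mv` is the barrier file's `medialVertexOf` (both `s(x, x + eᵢ)`). [folklore] -/
theorem mv_eq_medialVertexOf (p : Site 2 × Fin 2) : mv p = medialVertexOf p := rfl

/-- `medialVertexOf` is injective: the lattice edge `{x, x + eᵢ}` determines `(x, i)`. [folklore] -/
theorem medialVertexOf_injective : Function.Injective medialVertexOf := by
  rintro ⟨x, i⟩ ⟨y, j⟩ h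
  simp only [medialVertexOf, Sym2.eq_iff] at h
  rcases h with ⟨rfl, h⟩ | ⟨h1, h2⟩
  · have hij : (Pi.single i (1:ℤ) : Site 2) = Pi.single j 1 := add_left_cancel h
    have := congrFun hij i
    fin_cases i <;> fin_cases j <;> simp_all
  · exfalso
    have h3 := congrFun (h1.trans (congrArg (· + Pi.single j (1:ℤ)) h2).symm) i
    simp only [Pi.add_apply, Pi.single_eq_same] at h3
    fin_cases i <;> fin_cases j <;> simp at h3 <;> omega

/-- The class-indexed corner table of the sibling line (`pivotOf`/`classOffset`) lists the same
four corners as the clockwise table `medialCornersAt` (shifted by two for vertical edges). [folklore] -/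
theorem sum_classComp_pivotOf (Φ : Site 2 × Site 2 → ℂ) (x : Site 2) (i : Fin 2) :
    ∑ q : Fin 4, classComp Φ q (pivotOf x i q) = ∑ k : Fin 4, Φ (medialCornersAt x i k) := by
  fin_cases i
  · show ∑ q : Fin 4, classComp Φ q (pivotOf x 0 q) = ∑ k : Fin 4, Φ (medialCornersAt x 0 k)
    have key : ∀ q : Fin 4, classComp Φ q (pivotOf x 0 q) = Φ (medialCornersAt x 0 q) := by
      intro q
      simp only [classComp]
      congr 1
      fin_cases q <;>
        (refine Prod.ext ?_ ?_ <;>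
          (funext j; fin_cases j <;> simp [pivotOf, classOffset, medialCornersAt, ex, sub_eq_add_neg]))
    simp only [key]
  · show ∑ q : Fin 4, classComp Φ q (pivotOf x 1 q) = ∑ k : Fin 4, Φ (medialCornersAt x 1 k)
    have key : ∀ q : Fin 4, classComp Φ q (pivotOf x 1 q) = Φ (medialCornersAt x 1 (q + 2)) := by
      intro q
      simp only [classComp]
      congr 1
      fin_cases q <;>
        (refine Prod.ext ?_ ?_ <;>
          (funext j; fin_cases j <;> simp [pivotOf, classOffset, medialCornersAt, ex, sub_eq_add_neg]))
    simp only [Fin.sum_univ_four, key]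
    have e0 : ((0 : Fin 4) + 2) = 2 := rfl
    have e1 : ((1 : Fin 4) + 2) = 3 := rfl
    have e2 : ((2 : Fin 4) + 2) = 0 := rfl
    have e3 : ((3 : Fin 4) + 2) = 1 := rfl
    rw [e0, e1, e2, e3]
    ring

/-- A non-zero value of the crux observable sits at a genuine lattice edge `medialVertexOf p`. [folklore] -/
theorem exists_eq_medialVertexOf_of_F_ne_zero {Λ : ℝ → DiscreteDobrushin} {δ : ℝ} {z : MedialVertex}
    (h : F Λ δ z ≠ 0) : ∃ p : Site 2 × Fin 2, z = medialVertexOf p := by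
  by_contra hne
  refine h (Summit.CriticalPhenomena.CardyFormulaZ2.Theorems.ParafermionPrecompact.Negative.F_eq_zero_of_not_mem_edgeSet
    Λ δ fun hz => ?_)
  obtain ⟨x, i, rfl⟩ :=
    Summit.CriticalPhenomena.CardyFormulaZ2.Theorems.ParafermionPrecompact.Negative.exists_eq_mk_add_single hz
  exact hne ⟨(x, i), rfl⟩

/-! ## The per-vertex expansion of the weights and the abstract MASTER bound -/

/-- Expanding the weight `w(p,k) = a + i(−1)^{k+1} b − c·coeff i k·d` against the four corner values:
`Σ_k w(p,k)Φ(c_k) = a·Σ_kΦ + i b·(Φ₁+Φ₃−Φ₀−Φ₂) − c d·halfCRForm i p Φ`. [folklore] -/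
theorem sum_weight_expand (a b c d : ℂ) (Φ : Site 2 × Site 2 → ℂ) (p : Site 2 × Fin 2) :
    ∑ k : Fin 4, (a + Complex.I * (-1) ^ (k.val + 1) * b - c * coeff Complex.I k * d) *
        Φ (medialCornersAt p.1 p.2 k) =
      a * ∑ k : Fin 4, Φ (medialCornersAt p.1 p.2 k) +
        Complex.I * b * (Φ (medialCornersAt p.1 p.2 1) + Φ (medialCornersAt p.1 p.2 3) -
          Φ (medialCornersAt p.1 p.2 0) - Φ (medialCornersAt p.1 p.2 2)) -
        c * d * halfCRForm Complex.I p Φ := by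
  rw [_root_.Literature.Barriers.CriticalPhenomena.HalfCRGreen.halfCRForm_eq_sum]
  simp only [Fin.sum_univ_four, Fin.isValue, Fin.val_zero, Fin.val_one, Fin.val_two,
    show (3 : Fin 4).val = 3 from rfl,
    _root_.Literature.Barriers.CriticalPhenomena.HalfCRGreen.coeff_zero,
    _root_.Literature.Barriers.CriticalPhenomena.HalfCRGreen.coeff_one,
    _root_.Literature.Barriers.CriticalPhenomena.HalfCRGreen.coeff_two,
    _root_.Literature.Barriers.CriticalPhenomena.HalfCRGreen.coeff_three]
  ring

/-- **Abstract MASTER bound.** If the weights are supported (with their twins) in `S` and every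
symmetrised weight has norm `≤ ρ`, and `‖Φ‖ ≤ M` on corners of vertices of `S`, then
`‖Σ_{p∈S}Σ_k w(p,k)Φ(c_{p,k})‖ ≤ 2 ρ M |S|` (twin regrouping `stub_regroup`). [folklore] -/
theorem master_norm_bound (hreg : (∀ (S : Finset (Site 2 × Fin 2)) (w : Site 2 × Fin 2 → Fin 4 → ℂ) (Φ : Site 2 × Site 2 → ℂ),
      (∀ (p : Site 2 × Fin 2) (k : Fin 4), w p k ≠ 0 → p ∈ S ∧ twin p.1 p.2 k ∈ S) →
      ∑ p ∈ S, ∑ k : Fin 4, w p k * Φ (medialCornersAt p.1 p.2 k) =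
        (1 / 2 : ℂ) * ∑ p ∈ S, ∑ k : Fin 4,
          (w p k + w (twin p.1 p.2 k) (k + 2)) * Φ (medialCornersAt p.1 p.2 k)))
    (S : Finset (Site 2 × Fin 2)) (w : Site 2 × Fin 2 → Fin 4 → ℂ)
    (Φ : Site 2 × Site 2 → ℂ) {ρ M : ℝ} (hρ : 0 ≤ ρ) (_hM : 0 ≤ M)
    (hsupp : ∀ (p : Site 2 × Fin 2) (k : Fin 4), w p k ≠ 0 → p ∈ S ∧ twin p.1 p.2 k ∈ S)
    (hR : ∀ p ∈ S, ∀ k : Fin 4, ‖w p k + w (twin p.1 p.2 k) (k + 2)‖ ≤ ρ)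
    (hΦ : ∀ p ∈ S, ∀ k : Fin 4, ‖Φ (medialCornersAt p.1 p.2 k)‖ ≤ M) :
    ‖∑ p ∈ S, ∑ k : Fin 4, w p k * Φ (medialCornersAt p.1 p.2 k)‖ ≤ 2 * ρ * M * S.card := by
  rw [hreg S w Φ hsupp, norm_mul]
  have h1 : ‖∑ p ∈ S, ∑ k : Fin 4, (w p k + w (twin p.1 p.2 k) (k + 2)) * Φ (medialCornersAt p.1 p.2 k)‖
      ≤ ∑ p ∈ S, ∑ k : Fin 4, ρ * M := by
    refine (norm_sum_le _ _).trans (Finset.sum_le_sum fun p hp => (norm_sum_le _ _).trans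
      (Finset.sum_le_sum fun k _ => ?_))
    rw [norm_mul]
    exact mul_le_mul (hR p hp k) (hΦ p hp k) (norm_nonneg _) hρ
  have h2 : ∑ p ∈ S, ∑ k : Fin 4, ρ * M = 4 * (ρ * M) * S.card := by
    simp only [Finset.sum_const, Finset.card_univ, Fintype.card_fin, nsmul_eq_mul, Nat.cast_ofNat]
    ring
  have hn : ‖(1 / 2 : ℂ)‖ = 1 / 2 := by simp
  rw [hn]
  calc 1 / 2 * ‖∑ p ∈ S, ∑ k : Fin 4, (w p k + w (twin p.1 p.2 k) (k + 2)) * Φ (medialCornersAt p.1 p.2 k)‖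
      ≤ 1 / 2 * (4 * (ρ * M) * S.card) := by
        rw [← h2]; exact mul_le_mul_of_nonneg_left h1 (by norm_num)
    _ = 2 * ρ * M * S.card := by ring


/-! ## Real-power bookkeeping -/

/-- `δ · δ^{-5/3} = δ^{-2/3}` for `δ > 0`. [folklore] -/
theorem rpow_aux1 {δ : ℝ} (hδ : 0 < δ) : δ * δ ^ (-(5:ℝ) / 3) = δ ^ (-(2:ℝ) / 3) := by
  rw [show (-(2:ℝ) / 3) = 1 + (-(5:ℝ) / 3) by norm_num, Real.rpow_add hδ, Real.rpow_one]

/-- `δ^{-2/3} / δ = δ^{-5/3}` for `δ > 0`. [folklore] -/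
theorem rpow_aux2 {δ : ℝ} (hδ : 0 < δ) : δ ^ (-(2:ℝ) / 3) / δ = δ ^ (-(5:ℝ) / 3) := by
  rw [div_eq_iff hδ.ne', mul_comm, rpow_aux1 hδ]

/-- `δ^{5/3} · δ^{-5/3} = 1` for `δ > 0`. [folklore] -/
theorem rpow_aux3 {δ : ℝ} (hδ : 0 < δ) : δ ^ ((5:ℝ) / 3) * δ ^ (-(5:ℝ) / 3) = 1 := by
  rw [← Real.rpow_add hδ, show (5:ℝ) / 3 + -(5:ℝ) / 3 = 0 by norm_num, Real.rpow_zero]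

/-- `δ^{5/3} · (1 + δ⁻¹) ≤ 2 δ^{2/3}` for `0 < δ ≤ 1`. [folklore] -/
theorem rpow_aux4 {δ : ℝ} (hδ : 0 < δ) (hδ1 : δ ≤ 1) :
    δ ^ ((5:ℝ) / 3) * (1 + δ⁻¹) ≤ 2 * δ ^ ((2:ℝ) / 3) := by
  have h1 : δ ^ ((5:ℝ) / 3) * δ⁻¹ = δ ^ ((2:ℝ) / 3) := by
    rw [← Real.rpow_neg_one, ← Real.rpow_add hδ]; norm_num
  have h2 : δ ^ ((5:ℝ) / 3) ≤ δ ^ ((2:ℝ) / 3) :=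
    Real.rpow_le_rpow_of_exponent_ge hδ hδ1 (by norm_num)
  nlinarith [h1, h2]

/-! ## The deterministic core estimate at one mesh -/

/-- **Core estimate (one mesh, everything explicit).** With `ψ = ∂̄φ`, `ψ' = ∂φ` at the medial
points, the dart observable `Fd` (`‖Fd‖ ≤ 1`) and a splitting function `G` (`‖G‖ ≤ δ⁻¹`), the
`∂̄`-pairing of the corner sums is bounded by the Taylor error `2|C'C_φ|(1+δ⁻¹)·C_N` plus
`(2B_d + 8B_φ)` times the three `L¹` defects at scale `ε δ^{-5/3}`. [folklore] -/
theorem stub_coreEstimate (hreg : (∀ (S : Finset (Site 2 × Fin 2)) (w : Site 2 × Fin 2 → Fin 4 → ℂ) (Φ : Site 2 × Site 2 → ℂ),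
      (∀ (p : Site 2 × Fin 2) (k : Fin 4), w p k ≠ 0 → p ∈ S ∧ twin p.1 p.2 k ∈ S) →
      ∑ p ∈ S, ∑ k : Fin 4, w p k * Φ (medialCornersAt p.1 p.2 k) =
        (1 / 2 : ℂ) * ∑ p ∈ S, ∑ k : Fin 4,
          (w p k + w (twin p.1 p.2 k) (k + 2)) * Φ (medialCornersAt p.1 p.2 k)))
    (φ : ℂ → ℂ) (K : Set ℂ) (hKφ : ∀ z ∉ K, φ z = 0)
    (hKd : ∀ z ∉ K, fderiv ℝ φ z = 0) {Bφ Bd C' Cφ CN ε δ : ℝ}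
    (hBφ : ∀ z, ‖φ z‖ ≤ Bφ) (hBd1 : ∀ z, ‖(fderiv ℝ φ z 1 + Complex.I * fderiv ℝ φ z Complex.I) / 2‖ ≤ Bd)
    (hBd2 : ∀ z, ‖(fderiv ℝ φ z 1 - Complex.I * fderiv ℝ φ z Complex.I) / 2‖ ≤ Bd)
    (hδ : 0 < δ) (hδ1 : δ ≤ 1)
    (hT : ∀ (p : Site 2 × Fin 2) (k : Fin 4),
      dist (medialPoint δ (medialVertexOf p)) (medialPoint δ (medialVertexOf (twin p.1 p.2 k))) ≤ δ ∧
      ‖((fderiv ℝ φ (medialPoint δ (medialVertexOf p)) 1 +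
            Complex.I * fderiv ℝ φ (medialPoint δ (medialVertexOf p)) Complex.I) / 2 +
          Complex.I * (-1) ^ (k.val + 1) *
            ((fderiv ℝ φ (medialPoint δ (medialVertexOf p)) 1 -
              Complex.I * fderiv ℝ φ (medialPoint δ (medialVertexOf p)) Complex.I) / 2) -
          2 * (1 - Complex.I) / δ * coeff Complex.I k * φ (medialPoint δ (medialVertexOf p))) +
        ((fderiv ℝ φ (medialPoint δ (medialVertexOf (twin p.1 p.2 k))) 1 +
            Complex.I * fderiv ℝ φ (medialPoint δ (medialVertexOf (twin p.1 p.2 k))) Complex.I) / 2 +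
          Complex.I * (-1) ^ ((k + 2 : Fin 4).val + 1) *
            ((fderiv ℝ φ (medialPoint δ (medialVertexOf (twin p.1 p.2 k))) 1 -
              Complex.I * fderiv ℝ φ (medialPoint δ (medialVertexOf (twin p.1 p.2 k))) Complex.I) / 2) -
          2 * (1 - Complex.I) / δ * coeff Complex.I (k + 2) *
            φ (medialPoint δ (medialVertexOf (twin p.1 p.2 k))))‖ ≤ C' * Cφ * δ ^ 2)
    (S : Finset (Site 2 × Fin 2))
    (hS : ∀ p : Site 2 × Fin 2, medialPoint δ (medialVertexOf p) ∈ Metric.cthickening 1 K → p ∈ S)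
    (hcard : δ ^ 2 * (S.card : ℝ) ≤ CN)
    (Fd G : Site 2 × Site 2 → ℂ) (hFd : ∀ c, ‖Fd c‖ ≤ 1) (hG : ∀ c, ‖G c‖ ≤ δ⁻¹)
    (T : Finset (Site 2 × Fin 2)) (hTS : ∀ p ∈ S, medialPoint δ (medialVertexOf p) ∈ K → p ∈ T)
    (hV : ∑ p ∈ T, ‖halfCRForm Complex.I p Fd‖ ≤ ε * δ ^ (-(2:ℝ) / 3))
    (hSpl : ∑ p ∈ T,
      (‖halfCRForm Complex.I p G‖ / δ +
        ‖(Fd (medialCornersAt p.1 p.2 1) - G (medialCornersAt p.1 p.2 1)) +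
          (Fd (medialCornersAt p.1 p.2 3) - G (medialCornersAt p.1 p.2 3)) -
          (Fd (medialCornersAt p.1 p.2 0) - G (medialCornersAt p.1 p.2 0)) -
          (Fd (medialCornersAt p.1 p.2 2) - G (medialCornersAt p.1 p.2 2))‖ +
        ‖∑ k : Fin 4, G (medialCornersAt p.1 p.2 k)‖) ≤ ε * δ ^ (-(5:ℝ) / 3)) :
    ‖∑ p ∈ S, (fderiv ℝ φ (medialPoint δ (medialVertexOf p)) 1 +
        Complex.I * fderiv ℝ φ (medialPoint δ (medialVertexOf p)) Complex.I) / 2 *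
        ∑ k : Fin 4, Fd (medialCornersAt p.1 p.2 k)‖ ≤
      2 * |C' * Cφ| * (1 + δ⁻¹) * CN + (2 * Bd + 8 * Bφ) * ε * δ ^ (-(5:ℝ) / 3) := by
  classical
  -- notation-free abbreviations
  set zp : Site 2 × Fin 2 → ℂ := fun p => medialPoint δ (medialVertexOf p) with hzp
  set dbar : ℂ → ℂ := fun z => (fderiv ℝ φ z 1 + Complex.I * fderiv ℝ φ z Complex.I) / 2 with hdbar
  set del : ℂ → ℂ := fun z => (fderiv ℝ φ z 1 - Complex.I * fderiv ℝ φ z Complex.I) / 2 with hdel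
  set H : Site 2 × Site 2 → ℂ := fun c => Fd c - G c with hH
  set w : Site 2 × Fin 2 → Fin 4 → ℂ := fun p k =>
    dbar (zp p) + Complex.I * (-1) ^ (k.val + 1) * del (zp p) -
      2 * (1 - Complex.I) / δ * coeff Complex.I k * φ (zp p) with hw
  set SK : (Site 2 × Site 2 → ℂ) → Site 2 × Fin 2 → ℂ := fun Φ p =>
    Φ (medialCornersAt p.1 p.2 1) + Φ (medialCornersAt p.1 p.2 3) -
      Φ (medialCornersAt p.1 p.2 0) - Φ (medialCornersAt p.1 p.2 2) with hSK
  set A : (Site 2 × Site 2 → ℂ) → Site 2 × Fin 2 → ℂ := fun Φ p =>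
    ∑ k : Fin 4, Φ (medialCornersAt p.1 p.2 k) with hA
  have hBφ0 : 0 ≤ Bφ := (norm_nonneg _).trans (hBφ 0)
  have hBd0 : 0 ≤ Bd := (norm_nonneg _).trans (hBd1 0)
  -- values off K vanish
  have hdbar0 : ∀ z ∉ K, dbar z = 0 := fun z hz => by simp [hdbar, hKd z hz]
  have hdel0 : ∀ z ∉ K, del z = 0 := fun z hz => by simp [hdel, hKd z hz]
  have hdbarB : ∀ z, ‖dbar z‖ ≤ Bd := hBd1
  have hdelB : ∀ z, ‖del z‖ ≤ Bd := hBd2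
  -- (1) the per-vertex expansion, summed: Σ_p Σ_k w Φ = Σ dbar·A + I Σ del·SK − (2(1-I)/δ) Σ φ·vRes
  have hexpand : ∀ Φ : Site 2 × Site 2 → ℂ,
      ∑ p ∈ S, ∑ k : Fin 4, w p k * Φ (medialCornersAt p.1 p.2 k) =
        ∑ p ∈ S, dbar (zp p) * A Φ p + Complex.I * ∑ p ∈ S, del (zp p) * SK Φ p -
          2 * (1 - Complex.I) / δ * ∑ p ∈ S, φ (zp p) * halfCRForm Complex.I p Φ := by
    intro Φ
    rw [Finset.mul_sum, Finset.mul_sum, ← Finset.sum_add_distrib, ← Finset.sum_sub_distrib]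
    refine Finset.sum_congr rfl fun p _ => ?_
    rw [hw, hA, hSK]
    dsimp only
    rw [sum_weight_expand]
    ring
  -- (2) MASTER bound for H
  have hHnorm : ∀ c, ‖H c‖ ≤ 1 + δ⁻¹ := fun c =>
    (norm_sub_le _ _).trans (add_le_add (hFd c) (hG c))
  have hsupp : ∀ (p : Site 2 × Fin 2) (k : Fin 4), w p k ≠ 0 → p ∈ S ∧ twin p.1 p.2 k ∈ S := by
    intro p k hne
    have hzK : zp p ∈ K := by
      by_contra hz
      apply hne
      simp [hw, hdbar0 _ hz, hdel0 _ hz, hKφ _ hz]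
    refine ⟨hS p (Metric.self_subset_cthickening K hzK), hS _ ?_⟩
    refine Metric.mem_cthickening_of_dist_le _ (zp p) 1 K hzK ?_
    rw [dist_comm]
    exact ((hT p k).1).trans hδ1
  have hmaster : ‖∑ p ∈ S, ∑ k : Fin 4, w p k * H (medialCornersAt p.1 p.2 k)‖ ≤
      2 * (|C' * Cφ| * δ ^ 2) * (1 + δ⁻¹) * S.card :=
    master_norm_bound hreg S w H (by positivity) (by positivity) hsupp
      (fun p _ k => ((hT p k).2).trans (mul_le_mul_of_nonneg_right (le_abs_self _) (by positivity)))
      (fun p _ k => hHnorm _)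
  have hmaster' : ‖∑ p ∈ S, ∑ k : Fin 4, w p k * H (medialCornersAt p.1 p.2 k)‖ ≤
      2 * |C' * Cφ| * (1 + δ⁻¹) * CN := by
    refine hmaster.trans ?_
    have : 2 * (|C' * Cφ| * δ ^ 2) * (1 + δ⁻¹) * S.card = 2 * |C' * Cφ| * (1 + δ⁻¹) * (δ ^ 2 * S.card) := by
      ring
    rw [this]
    exact mul_le_mul_of_nonneg_left hcard (by positivity)
  -- (3) restriction of the K-supported sums to SKset and the three defect bounds
  have hrestrict : ∀ (g : ℂ → ℂ), (∀ z ∉ K, g z = 0) → ∀ (B : ℝ), (∀ z, ‖g z‖ ≤ B) → 0 ≤ B →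
      ∀ (X : Site 2 × Fin 2 → ℂ), ‖∑ p ∈ S, g (zp p) * X p‖ ≤ B * ∑ p ∈ T, ‖X p‖ := by
    intro g hg0 B hB hB0 X
    refine (norm_sum_le _ _).trans ?_
    have hle : ∀ p ∈ S, ‖g (zp p) * X p‖ ≤ if zp p ∈ K then B * ‖X p‖ else 0 := by
      intro p _
      split_ifs with h
      · rw [norm_mul]; exact mul_le_mul_of_nonneg_right (hB _) (norm_nonneg _)
      · rw [hg0 (zp p) h, zero_mul, norm_zero]
    refine (Finset.sum_le_sum hle).trans ?_
    rw [Finset.sum_ite, Finset.sum_const_zero, add_zero, ← Finset.mul_sum]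
    refine mul_le_mul_of_nonneg_left (Finset.sum_le_sum_of_subset_of_nonneg ?_ fun _ _ _ => norm_nonneg _) hB0
    intro p hp
    rw [Finset.mem_filter] at hp
    exact hTS p hp.1 hp.2
  have hSK_H : ∑ p ∈ T, ‖SK H p‖ ≤ ε * δ ^ (-(5:ℝ) / 3) := by
    refine le_trans (Finset.sum_le_sum fun p _ => ?_) hSpl
    have h1 : 0 ≤ ‖halfCRForm Complex.I p G‖ / δ := by positivity
    have h2 : 0 ≤ ‖∑ k : Fin 4, G (medialCornersAt p.1 p.2 k)‖ := norm_nonneg _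
    simp only [hSK, hH]
    linarith
  have hA_G : ∑ p ∈ T, ‖A G p‖ ≤ ε * δ ^ (-(5:ℝ) / 3) := by
    refine le_trans (Finset.sum_le_sum fun p _ => ?_) hSpl
    have h1 : 0 ≤ ‖halfCRForm Complex.I p G‖ / δ := by positivity
    have h2 : 0 ≤ ‖(Fd (medialCornersAt p.1 p.2 1) - G (medialCornersAt p.1 p.2 1)) +
          (Fd (medialCornersAt p.1 p.2 3) - G (medialCornersAt p.1 p.2 3)) -
          (Fd (medialCornersAt p.1 p.2 0) - G (medialCornersAt p.1 p.2 0)) -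
          (Fd (medialCornersAt p.1 p.2 2) - G (medialCornersAt p.1 p.2 2))‖ := norm_nonneg _
    simp only [hA]
    linarith
  have hR_G : ∑ p ∈ T, ‖halfCRForm Complex.I p G‖ ≤ δ * (ε * δ ^ (-(5:ℝ) / 3)) := by
    have h : ∑ p ∈ T, ‖halfCRForm Complex.I p G‖ / δ ≤ ε * δ ^ (-(5:ℝ) / 3) := by
      refine le_trans (Finset.sum_le_sum fun p _ => ?_) hSpl
      have h2 : 0 ≤ ‖(Fd (medialCornersAt p.1 p.2 1) - G (medialCornersAt p.1 p.2 1)) +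
          (Fd (medialCornersAt p.1 p.2 3) - G (medialCornersAt p.1 p.2 3)) -
          (Fd (medialCornersAt p.1 p.2 0) - G (medialCornersAt p.1 p.2 0)) -
          (Fd (medialCornersAt p.1 p.2 2) - G (medialCornersAt p.1 p.2 2))‖ := norm_nonneg _
      have h3 : 0 ≤ ‖∑ k : Fin 4, G (medialCornersAt p.1 p.2 k)‖ := norm_nonneg _
      linarith
    rw [← Finset.sum_div, div_le_iff₀ hδ] at h
    linarith
  have hR_H : ∑ p ∈ T, ‖halfCRForm Complex.I p H‖ ≤ 2 * (ε * δ ^ (-(2:ℝ) / 3)) := by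
    have hsub : ∀ p, halfCRForm Complex.I p H = halfCRForm Complex.I p Fd - halfCRForm Complex.I p G := by
      intro p
      have : H = Fd - G := by funext c; simp [hH]
      rw [this, map_sub]
    calc ∑ p ∈ T, ‖halfCRForm Complex.I p H‖
        ≤ ∑ p ∈ T, (‖halfCRForm Complex.I p Fd‖ + ‖halfCRForm Complex.I p G‖) :=
          Finset.sum_le_sum fun p _ => by rw [hsub]; exact norm_sub_le _ _
      _ = ∑ p ∈ T, ‖halfCRForm Complex.I p Fd‖ + ∑ p ∈ T, ‖halfCRForm Complex.I p G‖ :=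
          Finset.sum_add_distrib
      _ ≤ ε * δ ^ (-(2:ℝ) / 3) + δ * (ε * δ ^ (-(5:ℝ) / 3)) := add_le_add hV hR_G
      _ = 2 * (ε * δ ^ (-(2:ℝ) / 3)) := by rw [← mul_assoc δ, mul_comm δ ε, mul_assoc, rpow_aux1 hδ]; ring
  -- (4) assemble: Σ dbar·A[Fd] = (Σ Σ w H) − IΣ del SK[H] + (2(1−I)/δ)Σ φ vRes[H] + Σ dbar·A[G]
  have hAlin : ∀ p, A Fd p = A H p + A G p := fun p => by
    simp only [hA, hH, ← Finset.sum_add_distrib, sub_add_cancel]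
  have hkey : ∑ p ∈ S, dbar (zp p) * A Fd p =
      (∑ p ∈ S, ∑ k : Fin 4, w p k * H (medialCornersAt p.1 p.2 k)) -
        Complex.I * ∑ p ∈ S, del (zp p) * SK H p +
        2 * (1 - Complex.I) / δ * ∑ p ∈ S, φ (zp p) * halfCRForm Complex.I p H +
        ∑ p ∈ S, dbar (zp p) * A G p := by
    rw [hexpand H]
    have : ∑ p ∈ S, dbar (zp p) * A Fd p = ∑ p ∈ S, dbar (zp p) * A H p + ∑ p ∈ S, dbar (zp p) * A G p := by
      rw [← Finset.sum_add_distrib]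
      exact Finset.sum_congr rfl fun p _ => by rw [hAlin, mul_add]
    rw [this]
    ring
  have hn2 : ‖2 * (1 - Complex.I) / (δ : ℂ)‖ ≤ 4 / δ := by
    rw [norm_div, norm_mul, Complex.norm_real, Real.norm_of_nonneg hδ.le]
    refine div_le_div_of_nonneg_right ?_ hδ.le
    have : ‖(1 : ℂ) - Complex.I‖ ≤ 2 := (norm_sub_le _ _).trans (by norm_num [Complex.norm_I])
    have h2 : ‖(2 : ℂ)‖ = 2 := by simp
    rw [h2]; linarith
  have t1 : ‖Complex.I * ∑ p ∈ S, del (zp p) * SK H p‖ ≤ Bd * (ε * δ ^ (-(5:ℝ) / 3)) := by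
    rw [norm_mul, Complex.norm_I, one_mul]
    exact (hrestrict del hdel0 Bd hdelB hBd0 (SK H)).trans
      (mul_le_mul_of_nonneg_left hSK_H hBd0)
  have t2 : ‖2 * (1 - Complex.I) / δ * ∑ p ∈ S, φ (zp p) * halfCRForm Complex.I p H‖ ≤
      4 / δ * (Bφ * (2 * (ε * δ ^ (-(2:ℝ) / 3)))) := by
    rw [norm_mul]
    refine mul_le_mul hn2 ?_ (norm_nonneg _) (by positivity)
    exact (hrestrict φ hKφ Bφ hBφ hBφ0 _).trans
      (mul_le_mul_of_nonneg_left hR_H hBφ0)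
  have t3 : ‖∑ p ∈ S, dbar (zp p) * A G p‖ ≤ Bd * (ε * δ ^ (-(5:ℝ) / 3)) :=
    (hrestrict dbar hdbar0 Bd hdbarB hBd0 (A G)).trans
      (mul_le_mul_of_nonneg_left hA_G hBd0)
  have t2' : 4 / δ * (Bφ * (2 * (ε * δ ^ (-(2:ℝ) / 3)))) = 8 * Bφ * ε * δ ^ (-(5:ℝ) / 3) := by
    rw [← rpow_aux2 hδ]; ring
  -- the displayed goal is literally `‖Σ dbar(zp p) * A Fd p‖`
  show ‖∑ p ∈ S, dbar (zp p) * A Fd p‖ ≤ _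
  rw [hkey]
  calc ‖(∑ p ∈ S, ∑ k : Fin 4, w p k * H (medialCornersAt p.1 p.2 k)) -
        Complex.I * ∑ p ∈ S, del (zp p) * SK H p +
        2 * (1 - Complex.I) / δ * ∑ p ∈ S, φ (zp p) * halfCRForm Complex.I p H +
        ∑ p ∈ S, dbar (zp p) * A G p‖
      ≤ ‖∑ p ∈ S, ∑ k : Fin 4, w p k * H (medialCornersAt p.1 p.2 k)‖ +
          ‖Complex.I * ∑ p ∈ S, del (zp p) * SK H p‖ +
          ‖2 * (1 - Complex.I) / δ * ∑ p ∈ S, φ (zp p) * halfCRForm Complex.I p H‖ +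
          ‖∑ p ∈ S, dbar (zp p) * A G p‖ := by
        have hn4 : ∀ a b c d : ℂ, ‖a - b + c + d‖ ≤ ‖a‖ + ‖b‖ + ‖c‖ + ‖d‖ := fun a b c d => by
          linarith [norm_add_le (a - b + c) d, norm_add_le (a - b) c, norm_sub_le a b]
        exact hn4 _ _ _ _
    _ ≤ 2 * |C' * Cφ| * (1 + δ⁻¹) * CN + Bd * (ε * δ ^ (-(5:ℝ) / 3)) +
          4 / δ * (Bφ * (2 * (ε * δ ^ (-(2:ℝ) / 3)))) + Bd * (ε * δ ^ (-(5:ℝ) / 3)) :=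
        add_le_add (add_le_add (add_le_add hmaster' t1) t2) t3
    _ = 2 * |C' * Cφ| * (1 + δ⁻¹) * CN + (2 * Bd + 8 * Bφ) * ε * δ ^ (-(5:ℝ) / 3) := by
        rw [t2']; ring

end Summit.CriticalPhenomena.CardyFormulaZ2.Theorems.WeakHolomorphy.SplitBypass

end
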